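import Literature.Geometry.Kaehler.ComplexTorusHodgeGroupPiAnyNonCMEllipticCurvesProduct
import Literature.Geometry.Kaehler.ComplexTorusHodgeClassesProductHodgeGroupComplexPoints
import Literature.Geometry.Kaehler.ComplexTorusMumfordTateGroupProductEllipticCurves
import HarnessLib

/-!
# Complex points, the Mumford–Tate group and the extended Mumford–Tate group of `X₁ × ⋯ × X_K × Y` for ANY
# one-dimensional complex tori `X_k` without complex multiplication and a polarised torus `Y` with commutative
# `Hg(Y)(ℂ)`: `Hg(ℂ) = Hg(∏X_k)(ℂ) × Hg(Y)(ℂ)`, `MT(ℂ) = ℂ^× · (Hg(∏X_k)(ℂ) × Hg(Y)(ℂ))`,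
# `M̃T(ℝ) = M̃T(∏X_k)(ℝ) ×_{ℝ^×} M̃T(Y)(ℝ)` (Moonen–Zarhin 1999 §3 Theorem (2), (3.1); Moonen 1999 (1.13)–(1.14), 2004 §4–§5)

Layer `Literature/Geometry/Kaehler`, namespace `Literature.Geometry.Kaehler.ComplexTorus`; lane `lit-hodgefound`
(Track 2 foundations library), Layer A4; prover seat `lit-hodgefound-p17` (generation 36, self-proposed row g36-#8 =
the complex-points ∕ Mumford–Tate riders of g36-#6). Consumed BY NAME, nothing restated: g36-#6
`ComplexTorusHodgeGroupPiAnyNonCMEllipticCurvesProduct` (`hodgeGroup_pi_prod_eq_map_prod_of_forall_endAlgRat_eq_bot_of_comm`: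
the REAL product formula; `isAbelianVariety_pi_of_dimOne`), p40 `ComplexTorusHodgeClassesProductHodgeGroupComplexPoints`
(`IsRiemannForm.hodgeGroupC_prod_eq_of_hodgeGroup_prod_eq`: (ℝ) ⟹ (ℂ) for polarised tori, the density step), p40
`ComplexTorusHodgeGroupProductIrreducible` (`blockDiagProd`, `mem_blockDiagProd_iff`), `ComplexTorusMumfordTateGroupComplexPoints`
(`mem_mumfordTateGroupC_iff_exists_eq_scalar_mul`: `MT(X)(ℂ) = 𝔾_m · Hg(X)(ℂ)`), p34 `ComplexTorusMumfordTateGroupProductEllipticCurves`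
(`IsRiemannForm.extMumfordTateGroup_prod_eq_of_hodgeGroupC_prod_eq`: `Hg(ℂ)` splits ⟹ `M̃T(ℝ)` is the fibre product;
`extFiberProd`, `extProdGL`), g33 ∕ g35-#2 (the locus). THEOREMS ONLY (no definition, no instance, no notation, no named
fact; D-0026 net debt 0).

## Sources, verbatim

* B. Moonen, Yu. G. Zarhin, Math. Ann. **315** (1999) (held `paper:arxiv-math_9901113`), §3 Theorem (Hazama) (2),
  p0006 L74–L78 ("`Hg(X₁ × X₂) = Hg(X₁) × Hg(X₂)`"), (3.1), (0.2)(4), §2 (2.2) p0005 L26–L49 (`MT(X)`, `Hg(X) = U_F`).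
* B. Moonen, *Notes on Mumford–Tate groups* (1999), (1.13)–(1.14) (the fibre product over `𝔾_m` of the extended
  Mumford–Tate groups of a product); B. Moonen, *An introduction to Mumford–Tate groups* (2004), §4 Lemma 4.6, (4.7),
  §5 (5.2), (5.8).
* H. Lange, *Abelian Varieties over the Complex Numbers* (2023), §7.2.1 Remark 7.2.2 (2) ("`MT(X) = 𝔾_m · Hg(X)`").
* T. A. Springer, *Linear Algebraic Groups* (1998), §13.3 Cor. 13.3.9 (ii) (real points Zariski dense).

## What is proved (`X_k` one-dimensional with `End_ℚ(X_k) = ℚ`, any; `(Y, ω₂)` polarised with commutative `Hg(Y)(ℂ)`;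
`A = X₁ × ⋯ × X_K × Y`)

* §1 **`Hg(A)(ℂ) = Hg(X₁ × ⋯ × X_K)(ℂ) × Hg(Y)(ℂ)`** (`IsRiemannForm.hodgeGroupC_pi_prod_eq_blockDiagProd_of_comm`; on
  elements `IsRiemannForm.mem_hodgeGroupC_pi_prod_iff_of_comm`): the real product formula of g36-#6 and the density step.
* §2 **`MT(A)(ℂ) = ℂ^× · (Hg(∏X_k)(ℂ) × Hg(Y)(ℂ))`** on elements (`IsRiemannForm.mem_mumfordTateGroupC_pi_prod_iff_of_comm`),
  and **`M̃T(A)(ℝ) = M̃T(∏X_k)(ℝ) ×_{ℝ^×} M̃T(Y)(ℝ)`** (`IsRiemannForm.extMumfordTateGroup_pi_prod_eq_of_comm`, `K ≥ 1`,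
  `Y ≠ 0`).
* §3 The `E_τ` wording (only `End(E_{τ_k}) = ℤ`) and the locus `Y = ∏ₗ Z_l` (no polarisation hypothesis: locus tori are
  polarised).

## References

* [MoonenZarhin1999LowDim] B. Moonen, Yu. G. Zarhin, Math. Ann. 315 (1999), §3 Theorem (2), (3.1), §2 (2.2).
* [Moonen1999MTNotes] B. Moonen (1999), (1.13), (1.14).
* [Moonen2004MT] B. Moonen (2004), §4 Lemma 4.6, (4.7), §5 (5.2), (5.8).
* [Lange2023AbelianVarietiesComplex] H. Lange (2023), §7.2.1 Remark 7.2.2 (2).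
* [Springer1998] T. A. Springer (1998), §13.3 Cor. 13.3.9 (ii).
-/

noncomputable section

open scoped Real MatrixGroups
open Complex Module Matrix Function

namespace Literature.Geometry.Kaehler

namespace ComplexTorus

/-! ## §1 Complex points -/

section ComplexPoints

variable {K : ℕ} (X : Fin K → ((Fin 2 → ℝ) ≃L[ℝ] ℂ)) {ι₂ : Type*} [Fintype ι₂] [DecidableEq ι₂]
  {E₂ : Type*} [NormedAddCommGroup E₂] [NormedSpace ℂ E₂] (Φ₂ : (ι₂ → ℝ) ≃L[ℝ] E₂)
  (hX : ∀ k, endAlgRat (X k) = ⊥)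
  (hcomm : ∀ M N : SpecialLinearGroup ι₂ ℂ, M ∈ hodgeGroupC Φ₂ → N ∈ hodgeGroupC Φ₂ → M.1 * N.1 = N.1 * M.1)

include hX hcomm in
/-- **`Hg(X₁ × ⋯ × X_K × Y)(ℂ) = Hg(X₁ × ⋯ × X_K)(ℂ) × Hg(Y)(ℂ)`** (block-diagonally), for ANY one-dimensional tori
`X_k` without complex multiplication and a POLARISED torus `Y` with commutative `Hg(Y)(ℂ)`: g36-#6's real product
formula and the density step `Hg(ℝ)` Zariski dense in `Hg(ℂ)` (polarised factors).
[cite: MoonenZarhin1999LowDim, §3 Theorem (2) (p0006 L74–L78) and (3.1)] [cite: Springer1998, §13.3 Cor. 13.3.9 (ii)] -/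
theorem IsRiemannForm.hodgeGroupC_pi_prod_eq_blockDiagProd_of_comm {ω₂ : E₂ [⋀^Fin 2]→L[ℝ] ℝ}
    (h₂ : IsRiemannForm Φ₂ ω₂) :
    hodgeGroupC (prodPeriod (piPeriod X) Φ₂) = blockDiagProd (hodgeGroupC (piPeriod X)) (hodgeGroupC Φ₂) := by
  obtain ⟨ω₁, h₁⟩ := isAbelianVariety_pi_of_dimOne X
  exact h₁.hodgeGroupC_prod_eq_of_hodgeGroup_prod_eq h₂
    (hodgeGroup_pi_prod_eq_map_prod_of_forall_endAlgRat_eq_bot_of_comm X Φ₂ hX hcomm)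

include hX hcomm in
/-- The same in the `Subgroup.map` form `Hg(A)(ℂ) = (Hg(∏X_k)(ℂ) × Hg(Y)(ℂ)).map blockDiagC`.
[cite: MoonenZarhin1999LowDim, §3 Theorem (2) and (3.1)] -/
theorem IsRiemannForm.hodgeGroupC_pi_prod_eq_map_prod_of_comm {ω₂ : E₂ [⋀^Fin 2]→L[ℝ] ℝ} (h₂ : IsRiemannForm Φ₂ ω₂) :
    hodgeGroupC (prodPeriod (piPeriod X) Φ₂) =
      ((hodgeGroupC (piPeriod X)).prod (hodgeGroupC Φ₂)).map (blockDiagC (Fin K × Fin 2) ι₂) :=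
  IsRiemannForm.hodgeGroupC_pi_prod_eq_blockDiagProd_of_comm X Φ₂ hX hcomm h₂

include hX hcomm in
/-- **On elements: `M ∈ Hg(X₁ × ⋯ × X_K × Y)(ℂ) ⟺ M = (P 0; 0 t)` with `P ∈ Hg(∏X_k)(ℂ)` and `t ∈ Hg(Y)(ℂ)`.**
[cite: MoonenZarhin1999LowDim, §3 Theorem (2) and (3.1)] -/
theorem IsRiemannForm.mem_hodgeGroupC_pi_prod_iff_of_comm {ω₂ : E₂ [⋀^Fin 2]→L[ℝ] ℝ} (h₂ : IsRiemannForm Φ₂ ω₂)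
    {M : SpecialLinearGroup ((Fin K × Fin 2) ⊕ ι₂) ℂ} :
    M ∈ hodgeGroupC (prodPeriod (piPeriod X) Φ₂) ↔
      ∃ P ∈ hodgeGroupC (piPeriod X), ∃ t ∈ hodgeGroupC Φ₂, blockDiagC (Fin K × Fin 2) ι₂ (P, t) = M := by
  rw [IsRiemannForm.hodgeGroupC_pi_prod_eq_blockDiagProd_of_comm X Φ₂ hX hcomm h₂, mem_blockDiagProd_iff]

/-! ## §2 The Mumford–Tate group and the extended Mumford–Tate group -/

include hX hcomm in
/-- **`MT(X₁ × ⋯ × X_K × Y)(ℂ) = ℂ^× · (Hg(∏X_k)(ℂ) × Hg(Y)(ℂ))` on elements** (`MT(X)(ℂ) = 𝔾_m · Hg(X)(ℂ)`).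
[cite: Lange2023AbelianVarietiesComplex, §7.2.1 Remark 7.2.2 (2)] [cite: MoonenZarhin1999LowDim, §3 Theorem (2) and §2 (2.2)] -/
theorem IsRiemannForm.mem_mumfordTateGroupC_pi_prod_iff_of_comm {ω₂ : E₂ [⋀^Fin 2]→L[ℝ] ℝ} (h₂ : IsRiemannForm Φ₂ ω₂)
    {g : GL ((Fin K × Fin 2) ⊕ ι₂) ℂ} :
    g ∈ mumfordTateGroupC (prodPeriod (piPeriod X) Φ₂) ↔
      ∃ (α : ℂˣ) (P : SpecialLinearGroup (Fin K × Fin 2) ℂ) (t : SpecialLinearGroup ι₂ ℂ),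
        P ∈ hodgeGroupC (piPeriod X) ∧ t ∈ hodgeGroupC Φ₂ ∧
          g = Matrix.GeneralLinearGroup.scalar ((Fin K × Fin 2) ⊕ ι₂) α *
            Matrix.SpecialLinearGroup.toGL (blockDiagC (Fin K × Fin 2) ι₂ (P, t)) := by
  rw [mem_mumfordTateGroupC_iff_exists_eq_scalar_mul]
  constructor
  · rintro ⟨α, N, hN, rfl⟩
    obtain ⟨P, hP, t, ht, rfl⟩ := (IsRiemannForm.mem_hodgeGroupC_pi_prod_iff_of_comm X Φ₂ hX hcomm h₂).1 hN
    exact ⟨α, P, t, hP, ht, rfl⟩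
  · rintro ⟨α, P, t, hP, ht, rfl⟩
    exact ⟨α, _, (IsRiemannForm.mem_hodgeGroupC_pi_prod_iff_of_comm X Φ₂ hX hcomm h₂).2 ⟨P, hP, t, ht, rfl⟩, rfl⟩

include hX hcomm in
/-- **`M̃T(X₁ × ⋯ × X_K × Y)(ℝ) = M̃T(X₁ × ⋯ × X_K)(ℝ) ×_{ℝ^×} M̃T(Y)(ℝ)`** (the fibre product over the multiplier, real
points), `K ≥ 1`, `Y ≠ 0` — Moonen's (1.13)–(1.14) ∕ Lemma 4.6 for this product, from the splitting of `Hg(ℂ)`.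
[cite: Moonen1999MTNotes, (1.13), (1.14)] [cite: Moonen2004MT, §4 Lemma 4.6, (4.7) and §5 (5.2), (5.8)]
[cite: MoonenZarhin1999LowDim, §3 Theorem (2)] -/
theorem IsRiemannForm.extMumfordTateGroup_pi_prod_eq_of_comm [NeZero K] [Nonempty ι₂] {ω₂ : E₂ [⋀^Fin 2]→L[ℝ] ℝ}
    (h₂ : IsRiemannForm Φ₂ ω₂) :
    extMumfordTateGroup (prodPeriod (piPeriod X) Φ₂) =
      (extFiberProd (piPeriod X) Φ₂).map (extProdGL (Fin K × Fin 2) ι₂ ℝ) := by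
  haveI : Nonempty (Fin K × Fin 2) := ⟨(⟨0, Nat.pos_of_ne_zero (NeZero.ne K)⟩, 0)⟩
  obtain ⟨ω₁, h₁⟩ := isAbelianVariety_pi_of_dimOne X
  exact IsRiemannForm.extMumfordTateGroup_prod_eq_of_hodgeGroupC_prod_eq (piPeriod X) Φ₂ h₁ h₂
    (IsRiemannForm.hodgeGroupC_pi_prod_eq_map_prod_of_comm X Φ₂ hX hcomm h₂)

end ComplexPoints

/-! ## §3 Elliptic curves `E_{τ_k}`; the locus `Y = ∏ₗ Z_l` -/

section Elliptic

variable {K : ℕ} {τ : Fin K → ℂ} (hτ : ∀ k, (τ k).im ≠ 0) {ι₂ : Type*} [Fintype ι₂] [DecidableEq ι₂]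
  {E₂ : Type*} [NormedAddCommGroup E₂] [NormedSpace ℂ E₂] (Φ₂ : (ι₂ → ℝ) ≃L[ℝ] E₂)
  (hEnd : ∀ k, ellipticEnd (hτ k) = ⊥)
  (hcomm : ∀ M N : SpecialLinearGroup ι₂ ℂ, M ∈ hodgeGroupC Φ₂ → N ∈ hodgeGroupC Φ₂ → M.1 * N.1 = N.1 * M.1)

include hEnd hcomm in
/-- **`Hg(E_{τ_1} × ⋯ × E_{τ_K} × Y)(ℂ) = Hg(E_{τ_1} × ⋯ × E_{τ_K})(ℂ) × Hg(Y)(ℂ)`**, ANY non-CM `τ_k`, `(Y, ω₂)` polarised with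
commutative `Hg(Y)(ℂ)`. [cite: MoonenZarhin1999LowDim, §3 Theorem (2) and (3.1)] -/
theorem IsRiemannForm.hodgeGroupC_pi_ellipticPeriod_prod_eq_blockDiagProd {ω₂ : E₂ [⋀^Fin 2]→L[ℝ] ℝ}
    (h₂ : IsRiemannForm Φ₂ ω₂) :
    hodgeGroupC (prodPeriod (piPeriod fun k ↦ ellipticPeriod (hτ k)) Φ₂) =
      blockDiagProd (hodgeGroupC (piPeriod fun k ↦ ellipticPeriod (hτ k))) (hodgeGroupC Φ₂) :=
  IsRiemannForm.hodgeGroupC_pi_prod_eq_blockDiagProd_of_comm _ Φ₂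
    (fun k ↦ (endAlgRat_ellipticPeriod_eq_bot_iff (hτ k)).2 (hEnd k)) hcomm h₂

include hEnd hcomm in
/-- **`M̃T(E_{τ_1} × ⋯ × E_{τ_K} × Y)(ℝ) = M̃T(∏E_{τ_k})(ℝ) ×_{ℝ^×} M̃T(Y)(ℝ)`** (`K ≥ 1`, `Y ≠ 0`).
[cite: Moonen1999MTNotes, (1.13), (1.14)] [cite: Moonen2004MT, §4 Lemma 4.6 and §5 (5.2)] -/
theorem IsRiemannForm.extMumfordTateGroup_pi_ellipticPeriod_prod_eq [NeZero K] [Nonempty ι₂] {ω₂ : E₂ [⋀^Fin 2]→L[ℝ] ℝ}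
    (h₂ : IsRiemannForm Φ₂ ω₂) :
    extMumfordTateGroup (prodPeriod (piPeriod fun k ↦ ellipticPeriod (hτ k)) Φ₂) =
      (extFiberProd (piPeriod fun k ↦ ellipticPeriod (hτ k)) Φ₂).map (extProdGL (Fin K × Fin 2) ι₂ ℝ) :=
  IsRiemannForm.extMumfordTateGroup_pi_prod_eq_of_comm _ Φ₂
    (fun k ↦ (endAlgRat_ellipticPeriod_eq_bot_iff (hτ k)).2 (hEnd k)) hcomm h₂

end Elliptic

section Locus

variable {K : ℕ} (X : Fin K → ((Fin 2 → ℝ) ≃L[ℝ] ℂ))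
  {κ : Type*} [Fintype κ] [DecidableEq κ] {σ : κ → Type*} [∀ l, Fintype (σ l)] [∀ l, DecidableEq (σ l)]
  {F : κ → Type*} [∀ l, NormedAddCommGroup (F l)] [∀ l, NormedSpace ℂ (F l)] [∀ l, FiniteDimensional ℂ (F l)]
  (Ψ : ∀ l, (σ l → ℝ) ≃L[ℝ] F l) (hX : ∀ k, endAlgRat (X k) = ⊥)

include hX in
/-- **`Hg(X₁ × ⋯ × X_K × ∏ₗ Z_l)(ℂ) = Hg(∏X_k)(ℂ) × Hg(∏ₗ Z_l)(ℂ)`** for ANY non-CM one-dimensional `X_k` and any finite family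
of positive-dimensional tori on the Hodge-circle locus (these are polarised, with commutative `Hg(ℂ)`).
[cite: MoonenZarhin1999LowDim, §3 Theorem (2), (3.1) and §3 Corollary] -/
theorem hodgeGroupC_pi_prod_sigmaPiPeriod_eq_blockDiagProd_of_forall_endAlgRat_eq_bot (hg : ∀ l, 0 < finrank ℂ (F l))
    (h : ∀ l, (hodgeGroup (Ψ l) : Set (SpecialLinearGroup (σ l) ℝ)) = Set.range (hodgeCircleSL (Ψ l))) :
    hodgeGroupC (prodPeriod (piPeriod X) (sigmaPiPeriod Ψ)) =
      blockDiagProd (hodgeGroupC (piPeriod X)) (hodgeGroupC (sigmaPiPeriod Ψ)) := by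
  obtain ⟨ω₂, h₂⟩ := isAbelianVariety_sigmaPiPeriod_of_coe_eq_range Ψ hg h
  exact IsRiemannForm.hodgeGroupC_pi_prod_eq_blockDiagProd_of_comm X (sigmaPiPeriod Ψ) hX
    (fun _ _ hM hN ↦ congrArg Subtype.val (hodgeGroupC_sigmaPiPeriod_comm_of_coe_eq_range Ψ h hM hN)) h₂

include hX in
/-- **`MT(X₁ × ⋯ × X_K × ∏ₗ Z_l)(ℂ) = ℂ^× · (Hg(∏X_k)(ℂ) × Hg(∏ₗ Z_l)(ℂ))` on elements** (locus; `Hg(∏ₗ Z_l)(ℂ)` is the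
tree's `{diag_l ν_l(u_{d(l)})}`). [cite: Lange2023AbelianVarietiesComplex, §7.2.1 Remark 7.2.2 (2)]
[cite: MoonenZarhin1999LowDim, §3 Theorem (2) and §2 (2.2)] -/
theorem mem_mumfordTateGroupC_pi_prod_sigmaPiPeriod_iff_of_forall_endAlgRat_eq_bot (hg : ∀ l, 0 < finrank ℂ (F l))
    (h : ∀ l, (hodgeGroup (Ψ l) : Set (SpecialLinearGroup (σ l) ℝ)) = Set.range (hodgeCircleSL (Ψ l)))
    {g : GL ((Fin K × Fin 2) ⊕ Σ l, σ l) ℂ} :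
    g ∈ mumfordTateGroupC (prodPeriod (piPeriod X) (sigmaPiPeriod Ψ)) ↔
      ∃ (α : ℂˣ) (P : SpecialLinearGroup (Fin K × Fin 2) ℂ) (t : SpecialLinearGroup (Σ l, σ l) ℂ),
        P ∈ hodgeGroupC (piPeriod X) ∧ t ∈ hodgeGroupC (sigmaPiPeriod Ψ) ∧
          g = Matrix.GeneralLinearGroup.scalar ((Fin K × Fin 2) ⊕ Σ l, σ l) α *
            Matrix.SpecialLinearGroup.toGL (blockDiagC (Fin K × Fin 2) (Σ l, σ l) (P, t)) := by
  obtain ⟨ω₂, h₂⟩ := isAbelianVariety_sigmaPiPeriod_of_coe_eq_range Ψ hg h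
  exact IsRiemannForm.mem_mumfordTateGroupC_pi_prod_iff_of_comm X (sigmaPiPeriod Ψ) hX
    (fun _ _ hM hN ↦ congrArg Subtype.val (hodgeGroupC_sigmaPiPeriod_comm_of_coe_eq_range Ψ h hM hN)) h₂

include hX in
/-- **`M̃T(X₁ × ⋯ × X_K × ∏ₗ Z_l)(ℝ) = M̃T(∏X_k)(ℝ) ×_{ℝ^×} M̃T(∏ₗ Z_l)(ℝ)`** on the locus (`K ≥ 1`, the locus family
non-empty). [cite: Moonen1999MTNotes, (1.13), (1.14)] [cite: Moonen2004MT, §4 Lemma 4.6 and §5 (5.2)] -/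
theorem extMumfordTateGroup_pi_prod_sigmaPiPeriod_eq_of_forall_endAlgRat_eq_bot [NeZero K] [Nonempty (Σ l, σ l)]
    (hg : ∀ l, 0 < finrank ℂ (F l))
    (h : ∀ l, (hodgeGroup (Ψ l) : Set (SpecialLinearGroup (σ l) ℝ)) = Set.range (hodgeCircleSL (Ψ l))) :
    extMumfordTateGroup (prodPeriod (piPeriod X) (sigmaPiPeriod Ψ)) =
      (extFiberProd (piPeriod X) (sigmaPiPeriod Ψ)).map (extProdGL (Fin K × Fin 2) (Σ l, σ l) ℝ) := by
  obtain ⟨ω₂, h₂⟩ := isAbelianVariety_sigmaPiPeriod_of_coe_eq_range Ψ hg h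
  exact IsRiemannForm.extMumfordTateGroup_pi_prod_eq_of_comm X (sigmaPiPeriod Ψ) hX
    (fun _ _ hM hN ↦ congrArg Subtype.val (hodgeGroupC_sigmaPiPeriod_comm_of_coe_eq_range Ψ h hM hN)) h₂

end Locus

end ComplexTorus

end Literature.Geometry.Kaehler

end
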